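import Summits.QuantumFields.YangMills.Theorems.BalabanUVNodesN22W1RelCentredKernelBlockOfWalkRecord
import Literature.MathematicalPhysics.QuantumFieldTheory.Balaban1983to89.B13Sqrt27

/-!
# BalabanUVNodes ∕ node N22 = NE9 — THE RELATIVE-DISC CENTRED ROAD OVER THE ADMISSIBLE CLASS, MODULE J25: THE THREE COVARIANCE LETTERS OF THE LOCATED RECORD FROM NODE A's
# WALK RECORD — the largest eigenvalue of the reference covariance `C` (letter `c_E`), the quadratic form `⟨Γ₀X, CΓ₀X⟩ ≤ g‖X‖²` (letter `g`) and the localisation of `C⁻¹`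
# (letter `K_E`) are THEOREMS for a datum whose kernel record at the slice carries a walk record, by SCHUR'S TEST on the site torus with bounded fibres: `c_E := K̄_C·m·(1 + 2∕κ)^ν`,
# `g := c_E·(K̄_Γ·m·(1 + 2∕κ)^ν)²`, `K_E := K̄_E` (print: «this yields a constant O(1)», [II] p. 16 after (2.19))

Cell `pub-ymgap`, HUMAN RULING D-0062 (Track A), R134 ACCELERATION re-seat `pub-ymgap-dag-n22-c` (strategy s1), generation 11, file J25.  THEOREMS ONLY; imports J16
`…KernelBlockOfWalkRecord` (through it J12-D, NODE A's `B13TermWalkData` with `localisation17a_of_termWalkData` ∕ `JointWalkExpansion.majorants`, `B13Lemma3TorusPrimitive.kc_tdist1`) and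
`B13Sqrt27` (`eigenvalues_le_of_form_le`) BY NAME.  `--supports` K3⁷ `SpineGivenEndpointR13SepCoPH` (stmt-QuantumFields-20544) as a helper.

WHY.  Module J23 (`SliceInputsL2U.nonempty_of_blocks`, p588627) assembles the located record of one slice from the landed block producers' inputs; among its residual hypotheses are six
about three LETTERS OF THE REFERENCE COVARIANCE that no producer yet supplies: `hc0 ∕ hc : 0 ≤ c_E`, `λ_i(C) ≤ c_E` (the eigenvalues of NODE A's reference covariance `C = A(0,0)⁻¹ ≻ 0`),
`hg ∕ hΓq : 0 ≤ g`, `⟨Γ₀X, C Γ₀X⟩ ≤ g⟨X, X⟩` (the Gaussian quadratic form of the reference Γ-kernel), and `hKE ∕ hCE : 0 ≤ K_E`, `‖C⁻¹(b,b′)‖ ≤ K_E e^{−κ d₁(b,b′)}` (the localisation of the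
precision at the reference point).  All three follow from NODE A's walk record at the slice ([II] p. 13 ∕ p. 15, [Balaban1985BackgroundPropagators] Thm 3.10): L17a gives
`‖C(b,b′)‖ ≤ K̄_C e^{−κ d₁}`, `‖Γ₀(b,j)‖ ≤ K̄_Γ e^{−κ d₁}` (`localisation17a_of_termWalkData` at `u = 0`), the precision's walk expansion gives `‖A(0,0)(b,b′)‖ ≤ K̄_E e^{−κ d₁}`
(`JointWalkExpansion.majorants`), `C⁻¹ = A(0,0)` by the record's `hC0` and `C ≻ 0`, and SCHUR'S TEST on the site torus — absolute row ∕ column sums of an exponentially localised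
kernel with `≤ m` bonds per site are `≤ K̄·m·(1 + 2∕κ)^ν` (`kc_tdist1`, the printed «constant O(1)» after (2.19)) — bounds the Rayleigh quotient of `C` and the operator norm of `Γ₀`.

WHAT.  §1 (generic, real matrices): `sum_sq_mulVec_le_of_rowSum_le_of_colSum_le` (Schur's test `Σ((Ev)_i)² ≤ R·C·Σ v_k²`), `dotProduct_mulVec_le_of_rowSum_le_of_colSum_le`
(`⟨y, Sy⟩ ≤ R‖y‖²`), `sum_exp_neg_tdist1_le_of_fibre` (the torus lattice constant over a location map with fibres `≤ m`: `Σ_i e^{−b d₁(x, loc i)} ≤ m(1 + 2∕b)^ν`).  §2 (at the kernel record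
of a (2.14) datum slice): `absRowSum_C_le ∕ absColSum_C_le ∕ absRowSum_Γ₀_le ∕ absColSum_Γ₀_le` from the letters `hC216 ∕ hΓ₀` and the fibre counts, ★ `eigenvalues_C_le_of_hC216` (J23's
`hc` at `c_E := K₀·m·(1 + 2∕κ)^ν`), ★ `hΓq_of_hΓ₀_hC216` (J23's `hΓq` at `g := c_E·(K_Γ·m·(1 + 2∕κ)^ν)²`).  §3 (from the walk record): `cInvMap_eq_A2_zero` (`C⁻¹ ↪ ℂ = A(0,0)`),
★ `hCE_of_termWalkData` (J23's `hCE` at `K_E := K̄_E`, any rate `≤ w.kap`), ★ `eigenvalues_C_le_of_termWalkData`, ★ `hΓq_of_termWalkData` (the same two at NODE A's `K̄_C, K̄_Γ` and any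
rate `0 < κ ≤ w.kap`).  With these, a consumer of J23 instantiates `cE g KE` at NODE A's letters and discharges `hc0 hc hg hΓq hKE hCE` — six residual hypotheses fewer.

HONEST FRAMING — what this is NOT.  Count-neutral elementary linear algebra (Schur's test, Rayleigh quotient) on NODE A's LANDED letter shapes; NO estimate of Bałaban's is asserted;
whether Bałaban's kernels of record admit a walk record is NODE O's ∕ NODE A's statement, not claimed; N22 NOT discharged (typed 28∕28 · discharged 5∕27 UNCHANGED); one finite
four-torus programme at fixed ε — NOT infinite volume, NOT OS on ℝ⁴, NOT a mass gap, NOT Clay.  0 `sorry`, 0 `def`, standard axioms.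

References (TYPES only): [II] = [Balaban1988RG2Cluster] (1.5) p. 3, p. 13, (2.14)–(2.16) pp. 15–16, p. 16 after (2.19); [Balaban1985BackgroundPropagators] Thm 3.10 p. 416;
R. A. Horn, C. R. Johnson, Matrix Analysis §5.6 (Schur's test; folklore).
-/

noncomputable section

namespace YMDAG.N22.W1

open Set Metric Matrix
open scoped BigOperators
open Literature.MathematicalPhysics.QuantumFieldTheory.Balaban1983to89
open Literature.MathematicalPhysics.QuantumFieldTheory.Balaban1983to89.TreeLengthTorus (TPt TDom)
open Literature.MathematicalPhysics.QuantumFieldTheory.Balaban1983to89.B9Thm37GlueTorus (tdist1 tdist1_comm tdist1_nonneg)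
open Literature.MathematicalPhysics.QuantumFieldTheory.Balaban1983to89.B5TorusCover (UT)
open Literature.MathematicalPhysics.QuantumFieldTheory.Balaban1983to89.B13Lemma3TorusPrimitive (kc_tdist1)
open Literature.MathematicalPhysics.QuantumFieldTheory.Balaban1983to89.B13Sqrt27 (eigenvalues_le_of_form_le)
open Literature.MathematicalPhysics.QuantumFieldTheory.Balaban1983to89.B13TermWalkData
  (WalkConsts TermKernels TermWalkData localisation17a_of_termWalkData)
open Literature.MathematicalPhysics.QuantumFieldTheory.Balaban1983to89.Node00.Sect2 (domSys domCount CPair)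
open Literature.MathematicalPhysics.QuantumFieldTheory.Balaban1983to89.Node00.W1

/-! ## §1 Schur's test for real matrices; the torus lattice constant over a location map with bounded fibres -/

section Schur

variable {ι κ : Type*} [Fintype ι] [Fintype κ]

/-- **Schur's test** (Horn–Johnson §5.6) for a REAL matrix as a finite-sum inequality: absolute row sums `≤ R ≥ 0` and absolute column sums `≤ C` give `Σ_i ((E v)_i)² ≤ R·C·Σ_k v_k²`
(the tree's `Literature.Analysis.Matrix.sum_norm_sq_mulVec_le_of_rowSum_le_of_colSum_le` is the complex twin; same proof). [folklore] -/
theorem sum_sq_mulVec_le_of_rowSum_le_of_colSum_le (E : Matrix ι κ ℝ) {R C : ℝ} (hR : 0 ≤ R) (hrow : ∀ i, ∑ k, |E i k| ≤ R)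
    (hcol : ∀ k, ∑ i, |E i k| ≤ C) (v : κ → ℝ) : ∑ i, ((E *ᵥ v) i) ^ 2 ≤ R * C * ∑ k, (v k) ^ 2 := by
  have hpt : ∀ i, ((E *ᵥ v) i) ^ 2 ≤ R * ∑ k, |E i k| * (v k) ^ 2 := by
    intro i
    have h1 : |(E *ᵥ v) i| ≤ ∑ k, |E i k| * |v k| := by
      simp only [Matrix.mulVec, dotProduct]
      exact (Finset.abs_sum_le_sum_abs _ _).trans (le_of_eq (Finset.sum_congr rfl fun k _ => abs_mul _ _))
    have h2 : (∑ k, |E i k| * |v k|) ^ 2 ≤ (∑ k, |E i k|) * ∑ k, |E i k| * (v k) ^ 2 :=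
      Finset.sum_sq_le_sum_mul_sum_of_sq_le_mul _ (fun k _ => abs_nonneg _) (fun k _ => mul_nonneg (abs_nonneg _) (sq_nonneg _))
        (fun k _ => le_of_eq (by rw [mul_pow, sq_abs (v k)]; ring))
    have h0 : 0 ≤ ∑ k, |E i k| * (v k) ^ 2 := Finset.sum_nonneg fun k _ => by positivity
    calc ((E *ᵥ v) i) ^ 2 = |(E *ᵥ v) i| ^ 2 := (sq_abs _).symm
      _ ≤ (∑ k, |E i k| * |v k|) ^ 2 := pow_le_pow_left₀ (abs_nonneg _) h1 2
      _ ≤ (∑ k, |E i k|) * ∑ k, |E i k| * (v k) ^ 2 := h2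
      _ ≤ R * ∑ k, |E i k| * (v k) ^ 2 := mul_le_mul_of_nonneg_right (hrow i) h0
  calc ∑ i, ((E *ᵥ v) i) ^ 2 ≤ ∑ i, R * ∑ k, |E i k| * (v k) ^ 2 := Finset.sum_le_sum fun i _ => hpt i
    _ = R * ∑ k, (∑ i, |E i k|) * (v k) ^ 2 := by
        rw [← Finset.mul_sum, Finset.sum_comm]
        refine congrArg _ (Finset.sum_congr rfl fun k _ => ?_)
        rw [Finset.sum_mul]
    _ ≤ R * ∑ k, C * (v k) ^ 2 := by
        refine mul_le_mul_of_nonneg_left (Finset.sum_le_sum fun k _ => ?_) hR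
        exact mul_le_mul_of_nonneg_right (hcol k) (sq_nonneg _)
    _ = R * C * ∑ k, (v k) ^ 2 := by rw [← Finset.mul_sum, mul_assoc]

/-- **The Rayleigh quotient under Schur's test**: for a real square matrix whose absolute row AND column sums are `≤ R` (`R ≥ 0`), `⟨y, S y⟩ ≤ R·⟨y, y⟩` (Cauchy–Schwarz and §1's
Schur bound `‖Sy‖ ≤ R‖y‖`). [folklore] -/
theorem dotProduct_mulVec_le_of_rowSum_le_of_colSum_le (S : Matrix ι ι ℝ) {R : ℝ} (hR : 0 ≤ R) (hrow : ∀ i, ∑ k, |S i k| ≤ R)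
    (hcol : ∀ k, ∑ i, |S i k| ≤ R) (y : ι → ℝ) : y ⬝ᵥ (S *ᵥ y) ≤ R * (y ⬝ᵥ y) := by
  have hyy : y ⬝ᵥ y = ∑ i, (y i) ^ 2 := Finset.sum_congr rfl fun i _ => by rw [pow_two]
  have hy0 : 0 ≤ y ⬝ᵥ y := by rw [hyy]; exact Finset.sum_nonneg fun i _ => sq_nonneg _
  have hS := sum_sq_mulVec_le_of_rowSum_le_of_colSum_le S hR hrow hcol y
  have hcs : (y ⬝ᵥ (S *ᵥ y)) ^ 2 ≤ (∑ i, (y i) ^ 2) * ∑ i, ((S *ᵥ y) i) ^ 2 := Finset.sum_mul_sq_le_sq_mul_sq _ _ _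
  have hsq : (y ⬝ᵥ (S *ᵥ y)) ^ 2 ≤ (R * (y ⬝ᵥ y)) ^ 2 := by
    rw [← hyy] at hS hcs
    calc (y ⬝ᵥ (S *ᵥ y)) ^ 2 ≤ (y ⬝ᵥ y) * ∑ i, ((S *ᵥ y) i) ^ 2 := hcs
      _ ≤ (y ⬝ᵥ y) * (R * R * (y ⬝ᵥ y)) := mul_le_mul_of_nonneg_left hS hy0
      _ = (R * (y ⬝ᵥ y)) ^ 2 := by ring
  by_cases h : 0 ≤ y ⬝ᵥ (S *ᵥ y)
  · exact (pow_le_pow_iff_left₀ h (mul_nonneg hR hy0) two_ne_zero).1 hsq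
  · exact (not_le.1 h).le.trans (mul_nonneg hR hy0)

/-- **The torus lattice constant over a location map with bounded fibres**: if `loc : ι → UT N` has at most `m` points in every fibre, then
`Σ_{i : ι} e^{−b·d₁(x, loc i)} ≤ m·(1 + 2∕b)^ν` for every `x` and `b > 0` (the tree's `kc_tdist1` — print's «constant O(1)» after (2.19) — summed fibrewise).
[cite: Balaban1988RG2Cluster, p.16 after (2.19)] -/
theorem sum_exp_neg_tdist1_le_of_fibre {ν : ℕ} {N : Fin ν → ℕ} [∀ i, NeZero (N i)] (loc : ι → UT N) {m : ℕ}
    (hfib : ∀ x : UT N, (Finset.univ.filter fun i => loc i = x).card ≤ m) {b : ℝ} (hb : 0 < b) (x : UT N) :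
    ∑ i, Real.exp (-(b * tdist1 N x (loc i))) ≤ m * (1 + 2 / b) ^ ν := by
  classical
  rw [← Finset.sum_fiberwise_of_maps_to (s := Finset.univ) (t := Finset.univ.image loc) (g := loc) fun i hi => Finset.mem_image_of_mem loc hi]
  calc ∑ z ∈ Finset.univ.image loc, ∑ i ∈ Finset.univ.filter (fun i => loc i = z), Real.exp (-(b * tdist1 N x (loc i)))
      = ∑ z ∈ Finset.univ.image loc, ((Finset.univ.filter fun i => loc i = z).card : ℝ) * Real.exp (-(b * tdist1 N x z)) := by
        refine Finset.sum_congr rfl fun z _ => ?_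
        rw [Finset.sum_congr rfl fun i hi => by rw [(Finset.mem_filter.1 hi).2], Finset.sum_const, nsmul_eq_mul]
    _ ≤ ∑ z ∈ Finset.univ.image loc, (m : ℝ) * Real.exp (-(b * tdist1 N x z)) :=
        Finset.sum_le_sum fun z _ => mul_le_mul_of_nonneg_right (Nat.cast_le.2 (hfib z)) (Real.exp_nonneg _)
    _ = m * ∑ z ∈ Finset.univ.image loc, Real.exp (-(b * tdist1 N x z)) := by rw [Finset.mul_sum]
    _ ≤ m * (1 + 2 / b) ^ ν := mul_le_mul_of_nonneg_left (kc_tdist1 b hb _ x) (Nat.cast_nonneg _)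

end Schur

/-! ## §2 At the kernel record of a (2.14) datum slice: row ∕ column sums of `C` and `Γ₀`, the largest eigenvalue of `C`, the quadratic form of `Γ₀` -/

namespace SliceInputsL2U

variable {c : B13.Consts} {P : Params} {𝔸 : Type*} {M k L : ℕ} [NeZero L] (𝔇 : TermDatum214 c P 𝔸 M k L)
  (Z : (domSys P M (k + 1)).Dom) (t : TermLabel P M k L)

/-- The absolute ROW sums of the reference covariance under the letter `hC216` (`‖C(b,b′)‖ ≤ K₀ e^{−κ d₁(b,b′)}`, `K₀ ≥ 0`, `κ > 0`): `Σ_{b′} |C(b,b′)| ≤ K₀·m·(1 + 2∕κ)^ν`, the row bonds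
having `≤ m` members per site (the record's `hfib`). [cite: Balaban1988RG2Cluster, (2.16) p.16 and p.16 after (2.19)] -/
theorem absRowSum_C_le {K₀ κ : ℝ} (hK₀ : 0 ≤ K₀) (hκ : 0 < κ)
    (hC216 : ∀ b b', ‖(𝔇.𝒦 Z t).C b b'‖ ≤ K₀ * Real.exp (-(κ * tdist1 𝔇.Nf ((𝔇.𝒦 Z t).locΛ b) ((𝔇.𝒦 Z t).locΛ b')))) (b : (𝔇.𝒦 Z t).Λ) :
    ∑ b', |(𝔇.𝒦 Z t).C b b'| ≤ K₀ * ((𝔇.𝒦 Z t).m * (1 + 2 / κ) ^ 𝔇.ν) := by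
  calc ∑ b', |(𝔇.𝒦 Z t).C b b'| ≤ ∑ b', K₀ * Real.exp (-(κ * tdist1 𝔇.Nf ((𝔇.𝒦 Z t).locΛ b) ((𝔇.𝒦 Z t).locΛ b'))) :=
        Finset.sum_le_sum fun b' _ => (Real.norm_eq_abs _).symm.le.trans (hC216 b b')
    _ = K₀ * ∑ b', Real.exp (-(κ * tdist1 𝔇.Nf ((𝔇.𝒦 Z t).locΛ b) ((𝔇.𝒦 Z t).locΛ b'))) := by rw [Finset.mul_sum]
    _ ≤ K₀ * ((𝔇.𝒦 Z t).m * (1 + 2 / κ) ^ 𝔇.ν) := mul_le_mul_of_nonneg_left (sum_exp_neg_tdist1_le_of_fibre _ (𝔇.𝒦 Z t).hfib hκ _) hK₀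

/-- The absolute COLUMN sums of the reference covariance under `hC216`: the same constant (the letter's bound is symmetric in the two bonds, `tdist1_comm`).
[cite: Balaban1988RG2Cluster, (2.16) p.16 and p.16 after (2.19)] -/
theorem absColSum_C_le {K₀ κ : ℝ} (hK₀ : 0 ≤ K₀) (hκ : 0 < κ)
    (hC216 : ∀ b b', ‖(𝔇.𝒦 Z t).C b b'‖ ≤ K₀ * Real.exp (-(κ * tdist1 𝔇.Nf ((𝔇.𝒦 Z t).locΛ b) ((𝔇.𝒦 Z t).locΛ b')))) (b' : (𝔇.𝒦 Z t).Λ) :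
    ∑ b, |(𝔇.𝒦 Z t).C b b'| ≤ K₀ * ((𝔇.𝒦 Z t).m * (1 + 2 / κ) ^ 𝔇.ν) := by
  calc ∑ b, |(𝔇.𝒦 Z t).C b b'| ≤ ∑ b, K₀ * Real.exp (-(κ * tdist1 𝔇.Nf ((𝔇.𝒦 Z t).locΛ b') ((𝔇.𝒦 Z t).locΛ b))) :=
        Finset.sum_le_sum fun b _ => by rw [tdist1_comm]; exact (Real.norm_eq_abs _).symm.le.trans (hC216 b b')
    _ = K₀ * ∑ b, Real.exp (-(κ * tdist1 𝔇.Nf ((𝔇.𝒦 Z t).locΛ b') ((𝔇.𝒦 Z t).locΛ b))) := by rw [Finset.mul_sum]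
    _ ≤ K₀ * ((𝔇.𝒦 Z t).m * (1 + 2 / κ) ^ 𝔇.ν) := mul_le_mul_of_nonneg_left (sum_exp_neg_tdist1_le_of_fibre _ (𝔇.𝒦 Z t).hfib hκ _) hK₀

/-- The absolute ROW sums of the reference Γ-kernel under the letter `hΓ₀` (`‖Γ₀(b,j)‖ ≤ K_Γ e^{−κ d₁(b,j)}`) and the fibre count of the SITE locations `locN` (J23's `hfibN`):
`Σ_j |Γ₀(b,j)| ≤ K_Γ·m·(1 + 2∕κ)^ν`. [cite: Balaban1988RG2Cluster, (2.16) p.16 and p.16 after (2.19)] -/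
theorem absRowSum_Γ₀_le {KΓ κ : ℝ} (hKΓ : 0 ≤ KΓ) (hκ : 0 < κ)
    (hΓ₀ : ∀ b j, ‖(𝔇.𝒦 Z t).Γ₀ b j‖ ≤ KΓ * Real.exp (-(κ * tdist1 𝔇.Nf ((𝔇.𝒦 Z t).locΛ b) ((𝔇.𝒦 Z t).locN j))))
    (hfibN : ∀ x : UT 𝔇.Nf, (Finset.univ.filter fun j => (𝔇.𝒦 Z t).locN j = x).card ≤ (𝔇.𝒦 Z t).m) (b : (𝔇.𝒦 Z t).Λ) :
    ∑ j, |(𝔇.𝒦 Z t).Γ₀ b j| ≤ KΓ * ((𝔇.𝒦 Z t).m * (1 + 2 / κ) ^ 𝔇.ν) := by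
  calc ∑ j, |(𝔇.𝒦 Z t).Γ₀ b j| ≤ ∑ j, KΓ * Real.exp (-(κ * tdist1 𝔇.Nf ((𝔇.𝒦 Z t).locΛ b) ((𝔇.𝒦 Z t).locN j))) :=
        Finset.sum_le_sum fun j _ => (Real.norm_eq_abs _).symm.le.trans (hΓ₀ b j)
    _ = KΓ * ∑ j, Real.exp (-(κ * tdist1 𝔇.Nf ((𝔇.𝒦 Z t).locΛ b) ((𝔇.𝒦 Z t).locN j))) := by rw [Finset.mul_sum]
    _ ≤ KΓ * ((𝔇.𝒦 Z t).m * (1 + 2 / κ) ^ 𝔇.ν) := mul_le_mul_of_nonneg_left (sum_exp_neg_tdist1_le_of_fibre _ hfibN hκ _) hKΓ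

/-- The absolute COLUMN sums of the reference Γ-kernel under `hΓ₀` and the fibre count of the ROW-BOND locations (the record's `hfib`): `Σ_b |Γ₀(b,j)| ≤ K_Γ·m·(1 + 2∕κ)^ν`.
[cite: Balaban1988RG2Cluster, (2.16) p.16 and p.16 after (2.19)] -/
theorem absColSum_Γ₀_le {KΓ κ : ℝ} (hKΓ : 0 ≤ KΓ) (hκ : 0 < κ)
    (hΓ₀ : ∀ b j, ‖(𝔇.𝒦 Z t).Γ₀ b j‖ ≤ KΓ * Real.exp (-(κ * tdist1 𝔇.Nf ((𝔇.𝒦 Z t).locΛ b) ((𝔇.𝒦 Z t).locN j)))) (j : (𝔇.𝒦 Z t).Λ ⊕ (𝔇.𝒦 Z t).C₀) :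
    ∑ b, |(𝔇.𝒦 Z t).Γ₀ b j| ≤ KΓ * ((𝔇.𝒦 Z t).m * (1 + 2 / κ) ^ 𝔇.ν) := by
  calc ∑ b, |(𝔇.𝒦 Z t).Γ₀ b j| ≤ ∑ b, KΓ * Real.exp (-(κ * tdist1 𝔇.Nf ((𝔇.𝒦 Z t).locN j) ((𝔇.𝒦 Z t).locΛ b))) :=
        Finset.sum_le_sum fun b _ => by rw [tdist1_comm]; exact (Real.norm_eq_abs _).symm.le.trans (hΓ₀ b j)
    _ = KΓ * ∑ b, Real.exp (-(κ * tdist1 𝔇.Nf ((𝔇.𝒦 Z t).locN j) ((𝔇.𝒦 Z t).locΛ b))) := by rw [Finset.mul_sum]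
    _ ≤ KΓ * ((𝔇.𝒦 Z t).m * (1 + 2 / κ) ^ 𝔇.ν) := mul_le_mul_of_nonneg_left (sum_exp_neg_tdist1_le_of_fibre _ (𝔇.𝒦 Z t).hfib hκ _) hKΓ

/-- **★ THE LARGEST EIGENVALUE OF THE REFERENCE COVARIANCE FROM ITS LOCALISATION** — J23's hypothesis `hc` at the letter `c_E := K₀·m·(1 + 2∕κ)^ν`: every eigenvalue of NODE A's
reference covariance `C ≻ 0` is at most the Schur constant of its (2.16)-type localisation `hC216` (Rayleigh quotient ≤ max absolute row ∕ column sum). J23's `hc0` is then `0 ≤ c_E` (all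
factors nonnegative). [cite: Balaban1988RG2Cluster, (2.16) p.16 and p.16 after (2.19)] -/
theorem eigenvalues_C_le_of_hC216 {K₀ κ : ℝ} (hK₀ : 0 ≤ K₀) (hκ : 0 < κ)
    (hC216 : ∀ b b', ‖(𝔇.𝒦 Z t).C b b'‖ ≤ K₀ * Real.exp (-(κ * tdist1 𝔇.Nf ((𝔇.𝒦 Z t).locΛ b) ((𝔇.𝒦 Z t).locΛ b')))) (i : (𝔇.𝒦 Z t).Λ) :
    (𝔇.𝒦 Z t).hC.1.eigenvalues i ≤ K₀ * ((𝔇.𝒦 Z t).m * (1 + 2 / κ) ^ 𝔇.ν) :=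
  eigenvalues_le_of_form_le (𝔇.𝒦 Z t).hC.1
    (dotProduct_mulVec_le_of_rowSum_le_of_colSum_le _ (by positivity) (absRowSum_C_le 𝔇 Z t hK₀ hκ hC216) (absColSum_C_le 𝔇 Z t hK₀ hκ hC216)) i

/-- **★ THE GAUSSIAN QUADRATIC FORM OF THE REFERENCE Γ-KERNEL FROM THE LOCALISATIONS** — J23's hypothesis `hΓq` at the letter `g := c_E·(K_Γ·m·(1 + 2∕κ)^ν)²`:
`⟨Γ₀X, C Γ₀X⟩ ≤ c_E‖Γ₀X‖² ≤ c_E·(K_Γ m (1+2∕κ)^ν)²·‖X‖²` by the Rayleigh bound of `C` and Schur's test for `Γ₀` (row sums over the site locations `locN` with J23's fibre count `hfibN`,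
column sums over the row bonds). [cite: Balaban1988RG2Cluster, (2.16) p.16 and p.16 after (2.19)] -/
theorem hΓq_of_hΓ₀_hC216 {K₀ KΓ κ : ℝ} (hK₀ : 0 ≤ K₀) (hKΓ : 0 ≤ KΓ) (hκ : 0 < κ)
    (hC216 : ∀ b b', ‖(𝔇.𝒦 Z t).C b b'‖ ≤ K₀ * Real.exp (-(κ * tdist1 𝔇.Nf ((𝔇.𝒦 Z t).locΛ b) ((𝔇.𝒦 Z t).locΛ b'))))
    (hΓ₀ : ∀ b j, ‖(𝔇.𝒦 Z t).Γ₀ b j‖ ≤ KΓ * Real.exp (-(κ * tdist1 𝔇.Nf ((𝔇.𝒦 Z t).locΛ b) ((𝔇.𝒦 Z t).locN j))))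
    (hfibN : ∀ x : UT 𝔇.Nf, (Finset.univ.filter fun j => (𝔇.𝒦 Z t).locN j = x).card ≤ (𝔇.𝒦 Z t).m)
    (X : (𝔇.𝒦 Z t).Λ ⊕ (𝔇.𝒦 Z t).C₀ → ℝ) :
    ((𝔇.𝒦 Z t).Γ₀ *ᵥ X) ⬝ᵥ ((𝔇.𝒦 Z t).C *ᵥ ((𝔇.𝒦 Z t).Γ₀ *ᵥ X)) ≤
      (K₀ * ((𝔇.𝒦 Z t).m * (1 + 2 / κ) ^ 𝔇.ν) * (KΓ * ((𝔇.𝒦 Z t).m * (1 + 2 / κ) ^ 𝔇.ν)) ^ 2) * (X ⬝ᵥ X) := by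
  set cE : ℝ := K₀ * ((𝔇.𝒦 Z t).m * (1 + 2 / κ) ^ 𝔇.ν) with hcE
  set RΓ : ℝ := KΓ * ((𝔇.𝒦 Z t).m * (1 + 2 / κ) ^ 𝔇.ν) with hRΓ
  have hcE0 : 0 ≤ cE := by positivity
  have hRΓ0 : 0 ≤ RΓ := by positivity
  have h1 : ((𝔇.𝒦 Z t).Γ₀ *ᵥ X) ⬝ᵥ ((𝔇.𝒦 Z t).C *ᵥ ((𝔇.𝒦 Z t).Γ₀ *ᵥ X)) ≤ cE * (((𝔇.𝒦 Z t).Γ₀ *ᵥ X) ⬝ᵥ ((𝔇.𝒦 Z t).Γ₀ *ᵥ X)) :=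
    dotProduct_mulVec_le_of_rowSum_le_of_colSum_le _ hcE0 (absRowSum_C_le 𝔇 Z t hK₀ hκ hC216) (absColSum_C_le 𝔇 Z t hK₀ hκ hC216) _
  have h2 : ((𝔇.𝒦 Z t).Γ₀ *ᵥ X) ⬝ᵥ ((𝔇.𝒦 Z t).Γ₀ *ᵥ X) ≤ RΓ * RΓ * (X ⬝ᵥ X) := by
    have h := sum_sq_mulVec_le_of_rowSum_le_of_colSum_le (𝔇.𝒦 Z t).Γ₀ hRΓ0 (absRowSum_Γ₀_le 𝔇 Z t hKΓ hκ hΓ₀ hfibN) (absColSum_Γ₀_le 𝔇 Z t hKΓ hκ hΓ₀) X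
    have e1 : ((𝔇.𝒦 Z t).Γ₀ *ᵥ X) ⬝ᵥ ((𝔇.𝒦 Z t).Γ₀ *ᵥ X) = ∑ i, (((𝔇.𝒦 Z t).Γ₀ *ᵥ X) i) ^ 2 := Finset.sum_congr rfl fun i _ => by rw [pow_two]
    have e2 : X ⬝ᵥ X = ∑ i, (X i) ^ 2 := Finset.sum_congr rfl fun i _ => by rw [pow_two]
    rw [e1, e2]; exact h
  calc _ ≤ cE * (((𝔇.𝒦 Z t).Γ₀ *ᵥ X) ⬝ᵥ ((𝔇.𝒦 Z t).Γ₀ *ᵥ X)) := h1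
    _ ≤ cE * (RΓ * RΓ * (X ⬝ᵥ X)) := mul_le_mul_of_nonneg_left h2 hcE0
    _ = cE * RΓ ^ 2 * (X ⬝ᵥ X) := by ring

/-! ## §3 From NODE A's walk record: `C⁻¹ = A(0,0)` and its localisation (the letter `K_E := K̄_E`), and the two §2 letters at `(K̄_C, K̄_Γ)` -/

/-- **The precision at the reference point**: the record's `hC0 : A(0,0)⁻¹ = C ↪ ℂ` with `C ≻ 0` gives `C⁻¹ ↪ ℂ = A(0,0)` (both sides invertible; the ring embedding `ℝ ↪ ℂ`
commutes with the matrix inverse on invertible matrices). [cite: Balaban1988RG2Cluster, (2.14)-(2.15) p.15 (bookkeeping)] -/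
theorem cInvMap_eq_A2_zero : (𝔇.𝒦 Z t).C⁻¹.map (algebraMap ℝ ℂ) = (𝔇.𝒦 Z t).A2 0 0 := by
  have hdet : IsUnit (𝔇.𝒦 Z t).C.det := (𝔇.𝒦 Z t).hC.det_pos.ne'.isUnit
  have hmapdet : IsUnit ((𝔇.𝒦 Z t).C.map (algebraMap ℝ ℂ)).det := by
    rw [← RingHom.mapMatrix_apply, ← RingHom.map_det]; exact hdet.map _
  have hinv : ((𝔇.𝒦 Z t).C.map (algebraMap ℝ ℂ))⁻¹ = (𝔇.𝒦 Z t).C⁻¹.map (algebraMap ℝ ℂ) := by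
    refine Matrix.inv_eq_left_inv ?_
    rw [← Matrix.map_mul, Matrix.nonsing_inv_mul _ hdet, Matrix.map_one _ (map_zero _) (map_one _)]
  have hA : IsUnit ((𝔇.𝒦 Z t).A2 0 0).det := by
    rw [← Matrix.isUnit_nonsing_inv_det_iff, (𝔇.𝒦 Z t).hC0]; exact hmapdet
  rw [← hinv, ← (𝔇.𝒦 Z t).hC0, Matrix.nonsing_inv_nonsing_inv _ hA]

variable {w : WalkConsts} {α Rσ₀ : ℝ}

/-- **★ THE LOCALISATION OF `C⁻¹` FROM THE WALK RECORD** — J23's hypothesis `hCE` at the letter `K_E := K̄_E` and any rate `κ_b ≤ w.kap`: the walk expansion of the precision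
(`TermWalkData.hE`, `JointWalkExpansion.majorants` at the reference point `σ = 0`, `u = 0`) bounds `‖A(0,0)(b,b′)‖ ≤ K̄_E e^{−w.kap·d₁(b,b′)}`, and `C⁻¹ ↪ ℂ = A(0,0)`.  J23's `hKE` is
the package's `0 ≤ K̄_E`. [cite: Balaban1988RG2Cluster, p.13, p.15 and (2.16) p.16; Balaban1985BackgroundPropagators, Thm 3.10 p.416] -/
theorem hCE_of_termWalkData (hw : w.Admissible α Rσ₀) (hα : 0 < α)
    (h𝒦 : TermWalkData ({ (𝔇.𝒦 Z t) with } : TermKernels ({ c with κ₁ := c.κ₁ + 1 } : B13.Consts) P.d (domCount P M (k + 1)) 𝔇.ν 𝔇.Nf 𝔇.E₃) w)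
    {κb : ℝ} (hκb : κb ≤ w.kap) (b b' : (𝔇.𝒦 Z t).Λ) :
    ‖((𝔇.𝒦 Z t).C⁻¹.map (algebraMap ℝ ℂ)) b b'‖ ≤ w.KbarE * Real.exp (-(κb * tdist1 𝔇.Nf ((𝔇.𝒦 Z t).locΛ b) ((𝔇.𝒦 Z t).locΛ b'))) := by
  rw [cInvMap_eq_A2_zero]
  obtain ⟨W, T, SX, A, D, ρ, hEw⟩ := h𝒦.hE
  have hR : 0 < w.R := hα.trans hw.hαR
  have h := hEw.majorants hw.hε 0 (fun j => by rw [Pi.zero_apply, norm_zero]; exact (Real.exp_pos _).le) 0 (mem_ball_self hR) b b'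
  refine h.trans (mul_le_mul_of_nonneg_left (Real.exp_le_exp.2 ?_) hw.hKbarE)
  exact neg_le_neg (mul_le_mul_of_nonneg_right hκb (tdist1_nonneg _ _))

/-- **★ THE LARGEST EIGENVALUE OF `C` FROM THE WALK RECORD** — J23's `hc` at `c_E := K̄_C·m·(1 + 2∕κ)^ν` for any rate `0 < κ ≤ w.kap`: L17a at the reference configuration
(`localisation17a_of_termWalkData`, field `hC216`, rate dropped to `κ`) and §2. [cite: Balaban1988RG2Cluster, p.13, p.15, (2.16) p.16 and p.16 after (2.19); Balaban1985BackgroundPropagators, Thm 3.10 p.416] -/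
theorem eigenvalues_C_le_of_termWalkData (hw : w.Admissible α Rσ₀) (hα : 0 < α)
    (h𝒦 : TermWalkData ({ (𝔇.𝒦 Z t) with } : TermKernels ({ c with κ₁ := c.κ₁ + 1 } : B13.Consts) P.d (domCount P M (k + 1)) 𝔇.ν 𝔇.Nf 𝔇.E₃) w)
    {κ : ℝ} (hκ : 0 < κ) (hκw : κ ≤ w.kap) (i : (𝔇.𝒦 Z t).Λ) :
    (𝔇.𝒦 Z t).hC.1.eigenvalues i ≤ w.KbarC * ((𝔇.𝒦 Z t).m * (1 + 2 / κ) ^ 𝔇.ν) := by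
  have h17 := localisation17a_of_termWalkData hw hα.le h𝒦 (mem_ball_self (hα.trans hw.hαR))
  refine eigenvalues_C_le_of_hC216 𝔇 Z t hw.hKbarC hκ (fun b b' => (h17.hC216 b b').trans ?_) i
  exact mul_le_mul_of_nonneg_left (Real.exp_le_exp.2 (neg_le_neg (mul_le_mul_of_nonneg_right hκw (tdist1_nonneg _ _)))) hw.hKbarC

/-- **★ THE QUADRATIC FORM OF `Γ₀` FROM THE WALK RECORD** — J23's `hΓq` at `g := (K̄_C m (1+2∕κ)^ν)·(K̄_Γ m (1+2∕κ)^ν)²` for any rate `0 < κ ≤ w.kap`, given J23's fibre count of the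
site locations: L17a's `hΓ₀ ∕ hC216` at the reference configuration and §2. [cite: Balaban1988RG2Cluster, p.13, p.15, (2.16) p.16 and p.16 after (2.19); Balaban1985BackgroundPropagators, Thm 3.10 p.416] -/
theorem hΓq_of_termWalkData (hw : w.Admissible α Rσ₀) (hα : 0 < α)
    (h𝒦 : TermWalkData ({ (𝔇.𝒦 Z t) with } : TermKernels ({ c with κ₁ := c.κ₁ + 1 } : B13.Consts) P.d (domCount P M (k + 1)) 𝔇.ν 𝔇.Nf 𝔇.E₃) w)
    {κ : ℝ} (hκ : 0 < κ) (hκw : κ ≤ w.kap) (hfibN : ∀ x : UT 𝔇.Nf, (Finset.univ.filter fun j => (𝔇.𝒦 Z t).locN j = x).card ≤ (𝔇.𝒦 Z t).m)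
    (X : (𝔇.𝒦 Z t).Λ ⊕ (𝔇.𝒦 Z t).C₀ → ℝ) :
    ((𝔇.𝒦 Z t).Γ₀ *ᵥ X) ⬝ᵥ ((𝔇.𝒦 Z t).C *ᵥ ((𝔇.𝒦 Z t).Γ₀ *ᵥ X)) ≤
      (w.KbarC * ((𝔇.𝒦 Z t).m * (1 + 2 / κ) ^ 𝔇.ν) * (w.KbarΓ * ((𝔇.𝒦 Z t).m * (1 + 2 / κ) ^ 𝔇.ν)) ^ 2) * (X ⬝ᵥ X) := by
  have h17 := localisation17a_of_termWalkData hw hα.le h𝒦 (mem_ball_self (hα.trans hw.hαR))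
  have hdrop : ∀ x : ℝ, 0 ≤ x → Real.exp (-(w.kap * x)) ≤ Real.exp (-(κ * x)) := fun x hx =>
    Real.exp_le_exp.2 (neg_le_neg (mul_le_mul_of_nonneg_right hκw hx))
  exact hΓq_of_hΓ₀_hC216 𝔇 Z t hw.hKbarC hw.hKbarΓ hκ
    (fun b b' => (h17.hC216 b b').trans (mul_le_mul_of_nonneg_left (hdrop _ (tdist1_nonneg _ _)) hw.hKbarC))
    (fun b j => (h17.hΓ₀ b j).trans (mul_le_mul_of_nonneg_left (hdrop _ (tdist1_nonneg _ _)) hw.hKbarΓ)) hfibN X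

end SliceInputsL2U

end YMDAG.N22.W1

end
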